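import Summits.MatrixMultiplication.MatrixMultiplication.Theorems.FarEdgeDescentAnchorLaw
import Mathlib.Analysis.Convex.Mul
import HarnessLib

/-!
# Route `FarEdgeDescent` — ANCHOR INDEPENDENCE I: two lawful worlds deciding the upward law `L(a) ⟹ L(b)`
(lens-2 «special vs generic», gen 43, Kernel XVIII; support module for the crux `AnchoredLogConvexity`
stmt-MatrixMultiplication-28900; companion of `FarEdgeDescentAnchorLaw` / `FarEdgeDescentAnchorValue` /
`FarEdgeDescentHarmonicWorld`; def-free; the cut of record `closes (h₁ : FiniteSaturation)
(h₂ : AnchoredLogConvexity)` is UNCHANGED; the readings for the true exponents are in the sequel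
`FarEdgeDescentAnchorUpward`)

`e(x) := ω(1,x,1) − (x+1)` (tree `omegaRect ℂ 1 x 1 - (x + 1)`), and the anchored family (always inline)
`L(a) : ∀ m > a, e(m)² ≤ e(a)·e(2m − a)`; `L(1)` is the crux `AnchoredLogConvexity` verbatim
(`FarEdgeDescentAnchorLaw.anchoredLaw_one_iff`).  The one MEMBER-FREE statement of the family left undecided by
Kernel XVII (memo U12 / N17, critic g15 s2) is the UPWARD LAW `AnchoredUpward : ∀ a ≤ b, L(a) ⟹ L(b)`.  Next to
the special leaf it holds (`FarEdgeDescentAnchorValue.anchoredLaw_mono_of_finiteSaturation`: the family is the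
onset dial).  This file decides it WITHOUT the special leaf, by TWO LAWFUL WORLDS fed to the landed far-tail
freedom theorem `FarEdgeDescentTailShadow.farTail_realisable` (3D-lawful: symmetric, positively homogeneous,
subadditive, monotone in the middle argument, sandwiched between `max(x+z,x+y,y+z)` and `x+y+z`):

* §1–§2 the SECANT-BENT HARMONIC WORLD (`bentWorld`): far excess `E(x) = max(1/(4x), (b+c−x)/(4bc))` — the
  harmonic excess `1/(4x)` of `FarEdgeDescentHarmonicWorld` with its CHORD over `[b,c]`, `c = (a²+b²)/(2a)`,
  glued in (secant surgery keeps convex / antitone / positive and the cube line; §1 is the elementary algebra of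
  `E`).  For all far anchors `1 ≤ a < b`: **`L_W(a)` holds and `L_W(b)` FAILS** (an affine stretch right of
  `b` is strictly log-concave: AM–GM gap `(b−c)²/(64b²c²)`), `L_W(a')` holds again for every `a' ≥ c`,
  `W(1,1,1) = 9/4`, no saturated length.  So **the upward law is NOT a shape law** — for ANY pair of far
  anchors — and the truth set of the family can have a hole.
* §2 the KINK WORLD (`kinkWorld`, the world of `FarEdgeDescentAnchorLaw.anchoredLaw_insufficient_of_one_lt` with
  its truth set computed): far excess `(b−x)₊/(b+2)`; special-leaf shape at `⌈b⌉`, truth set on the far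
  anchors EXACTLY the up-set `[b,∞)` (so the converse `L(b) ⟹ L(a)` is not a shape law either, and the upward
  law coexists with the special-leaf shape and `W(1,1,1) = 2 + (b−1)/(b+2) > 2`).

Nothing here proves `ω = 2`; no tensor mechanism for any `L(a)` is claimed (leaf tag IDEA-NEEDED unchanged).
[cite: LottiRomani1983, §2 (p. 174)] [cite: HuangPan1998, §2 eq. (2.5)–(2.8)] [cite: Coppersmith1997, §1]
-/

set_option linter.dupNamespace false

noncomputable section

namespace Summit.MatrixMultiplication.MatrixMultiplication.Theorems.FarEdgeDescentAnchorIndependence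

open Literature.Computability.AlgebraicComplexity Set
open Summit.MatrixMultiplication.MatrixMultiplication.Theses.FarEdgeDescent
open Summit.MatrixMultiplication.MatrixMultiplication.Theorems.FarEdgeDescentTailShadow
open Summit.MatrixMultiplication.MatrixMultiplication.Theorems.FarEdgeDescentAnchorLaw

/-! ## §1 The secant-bent harmonic excess `E(x) = max(1/(4x), (b+c−x)/(4bc))` -/

/-- Secant versus hyperbola: `(b+c−x)/(4bc) ≤ 1/(4x) ⟺ (x−b)(c−x) ≤ 0` (`x, b, c > 0`) — the chord of `1/(4x)`
over `[b,c]` lies above the hyperbola exactly on `[b,c]`. -/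
theorem secant_le_harmonic_iff {b c x : ℝ} (hb : 0 < b) (hc : 0 < c) (hx : 0 < x) :
    (b + c - x) / (4 * b * c) ≤ 1 / (4 * x) ↔ (x - b) * (c - x) ≤ 0 := by
  rw [div_le_div_iff₀ (by positivity) (by positivity)]
  constructor <;> intro h <;> nlinarith

/-- Off `(b,c)` the bent excess IS the harmonic excess. -/
theorem bent_eq_harmonic {b c x : ℝ} (hb : 0 < b) (hc : 0 < c) (hx : 0 < x) (h : (x - b) * (c - x) ≤ 0) :
    max (1 / (4 * x)) ((b + c - x) / (4 * b * c)) = 1 / (4 * x) :=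
  max_eq_left ((secant_le_harmonic_iff hb hc hx).2 h)

/-- At the left end of the chord: `E(b) = 1/(4b)`. -/
theorem bent_at_left {b c : ℝ} (hb : 0 < b) (hc : 0 < c) :
    max (1 / (4 * b)) ((b + c - b) / (4 * b * c)) = 1 / (4 * b) :=
  bent_eq_harmonic hb hc hb (by simp)

/-- At the right end of the chord: `E(c) = 1/(4c)`. -/
theorem bent_at_right {b c : ℝ} (hb : 0 < b) (hc : 0 < c) :
    max (1 / (4 * c)) ((b + c - c) / (4 * b * c)) = 1 / (4 * c) :=
  bent_eq_harmonic hb hc hc (by simp)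

/-- Beyond the chord: `E(x) = 1/(4x)` for `x ≥ c ≥ b > 0`. -/
theorem bent_of_ge {b c x : ℝ} (hb : 0 < b) (hbc : b ≤ c) (hx : c ≤ x) :
    max (1 / (4 * x)) ((b + c - x) / (4 * b * c)) = 1 / (4 * x) :=
  bent_eq_harmonic hb (by linarith) (by linarith)
    (by nlinarith [mul_nonneg (sub_nonneg.2 (hbc.trans hx)) (sub_nonneg.2 hx)])

/-- The bent excess is positive on `(0,∞)` (it lies above the hyperbola). -/
theorem bent_pos {b c x : ℝ} (hx : 0 < x) : 0 < max (1 / (4 * x)) ((b + c - x) / (4 * b * c)) :=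
  lt_of_lt_of_le (by positivity) (le_max_left _ _)

/-- Value at the square: `E(1) = 1/4` as soon as `b, c ≥ 1`. -/
theorem bent_at_one {b c : ℝ} (hb : 1 ≤ b) (hc : 1 ≤ c) :
    max (1 / (4 * (1 : ℝ))) ((b + c - 1) / (4 * b * c)) = 1 / 4 := by
  rw [mul_one]
  apply max_eq_left
  rw [div_le_div_iff₀ (by positivity) (by norm_num)]
  nlinarith [mul_nonneg (sub_nonneg.2 hb) (sub_nonneg.2 hc)]

/-- `E` is convex on `[1,∞)`: the maximum of the convex branch `1/(4x)` and an affine function. -/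
theorem bent_convexOn {b c : ℝ} (hb : 0 < b) (hc : 0 < c) :
    ConvexOn ℝ (Ici (1 : ℝ)) (fun x : ℝ => max (1 / (4 * x)) ((b + c - x) / (4 * b * c))) := by
  have hinv : ConvexOn ℝ (Ioi (0 : ℝ)) (fun x : ℝ => x⁻¹) := by
    simpa [zpow_neg, zpow_one] using (convexOn_zpow (-1) : ConvexOn ℝ (Ioi (0 : ℝ)) fun x : ℝ => x ^ (-1 : ℤ))
  have h1 : ConvexOn ℝ (Ioi (0 : ℝ)) (fun x : ℝ => (1 / 4 : ℝ) • x⁻¹) := hinv.smul (by norm_num)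
  have h2 : ConvexOn ℝ (Ici (1 : ℝ)) (fun x : ℝ => (1 / 4 : ℝ) • x⁻¹) :=
    h1.subset (fun x (hx : 1 ≤ x) => show (0 : ℝ) < x by linarith) (convex_Ici _)
  have h3 : ConvexOn ℝ (Ici (1 : ℝ)) (fun x : ℝ => 1 / (4 * x)) := by
    refine h2.congr fun x hx => ?_
    have hx0 : (0 : ℝ) < x := lt_of_lt_of_le one_pos hx
    simp only [smul_eq_mul]
    field_simp
  have hb0 : b ≠ 0 := ne_of_gt hb
  have hc0 : c ≠ 0 := ne_of_gt hc
  have h4 : ConvexOn ℝ (Ici (1 : ℝ)) (fun x : ℝ => (b + c - x) / (4 * b * c)) := by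
    refine ⟨convex_Ici 1, ?_⟩
    intro x _ y _ p q _ _ hpq
    obtain rfl : q = 1 - p := by linarith
    simp only [smul_eq_mul]
    apply le_of_eq
    field_simp
    ring
  exact h3.sup h4

/-- `E` is antitone on `[1,∞)`. -/
theorem bent_antitoneOn {b c : ℝ} (hb : 0 < b) (hc : 0 < c) :
    AntitoneOn (fun x : ℝ => max (1 / (4 * x)) ((b + c - x) / (4 * b * c))) (Ici (1 : ℝ)) := by
  intro x hx y _ hxy
  have hx1 : (1 : ℝ) ≤ x := hx
  exact max_le_max (one_div_le_one_div_of_le (by linarith) (by linarith))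
    (div_le_div_of_nonneg_right (by linarith) (by positivity))

/-- `E` meets the cube line: `E(1) − E(x) ≤ (1 − E(1))/3 · (x − 1)` on `[1,∞)` (`E(1) = 1/4`, `E ≥ 1/(4x)`). -/
theorem bent_cube {b c : ℝ} (hb : 1 ≤ b) (hc : 1 ≤ c) (x : ℝ) (hx : 1 ≤ x) :
    max (1 / (4 * (1 : ℝ))) ((b + c - 1) / (4 * b * c)) - max (1 / (4 * x)) ((b + c - x) / (4 * b * c)) ≤
      (1 - max (1 / (4 * (1 : ℝ))) ((b + c - 1) / (4 * b * c))) / 3 * (x - 1) := by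
  rw [bent_at_one hb hc]
  have hx0 : 0 < x := by linarith
  have h1 : 1 / (4 * x) ≤ max (1 / (4 * x)) ((b + c - x) / (4 * b * c)) := le_max_left _ _
  have h2 : 1 / 4 - 1 / (4 * x) ≤ (x - 1) / 4 := by
    rw [show (1 : ℝ) / 4 - 1 / (4 * x) = (x - 1) / (4 * x) by field_simp]
    exact div_le_div_of_nonneg_left (by linarith) (by norm_num) (by linarith)
  linarith

/-- **`L(a)` SURVIVES the surgery** when the chord sits right of `a` and ends before `a(2c − a) = b²`:
for `0 < a < b < c`, `a(2c−a) ≤ b²` and every `m > a`, `E(m)² ≤ E(a)·E(2m−a)`.  (Off the chord this is the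
harmonic identity `E(a)E(2m−a) − E(m)² = (m−a)²/(16am²(2m−a))`; on the chord `E(m) ≤ E(b) = 1/(4b)` and
`16a(2m−a) ≤ 16b²`.) -/
theorem bent_law {a b c : ℝ} (ha : 0 < a) (hab : a < b) (hbc : b < c) (hkey : a * (2 * c - a) ≤ b ^ 2)
    {m : ℝ} (hm : a < m) :
    (max (1 / (4 * m)) ((b + c - m) / (4 * b * c))) ^ 2 ≤
      max (1 / (4 * a)) ((b + c - a) / (4 * b * c)) *
        max (1 / (4 * (2 * m - a))) ((b + c - (2 * m - a)) / (4 * b * c)) := by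
  have hb : 0 < b := by linarith
  have hc : 0 < c := by linarith
  have hm0 : 0 < m := by linarith
  have h2ma : 0 < 2 * m - a := by linarith
  rw [bent_eq_harmonic hb hc ha (by nlinarith)]
  have hR : 1 / (4 * a) * (1 / (4 * (2 * m - a))) ≤
      1 / (4 * a) * max (1 / (4 * (2 * m - a))) ((b + c - (2 * m - a)) / (4 * b * c)) :=
    mul_le_mul_of_nonneg_left (le_max_left _ _) (by positivity)
  refine le_trans ?_ hR
  have h16 : 0 < 16 * a * (2 * m - a) := by positivity
  rw [show 1 / (4 * a) * (1 / (4 * (2 * m - a))) = 1 / (16 * a * (2 * m - a)) by field_simp; ring]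
  rcases le_total ((b + c - m) / (4 * b * c)) (1 / (4 * m)) with h | h
  · rw [max_eq_left h, show (1 / (4 * m)) ^ 2 = 1 / (16 * m ^ 2) by field_simp; ring]
    exact one_div_le_one_div_of_le h16 (by nlinarith [sq_nonneg (m - a)])
  · rw [max_eq_right h]
    have hprod : b * c ≤ m * (b + c - m) := by
      have := (div_le_div_iff₀ (by positivity) (by positivity)).1 h
      nlinarith
    have hbm : b ≤ m := by
      by_contra hlt
      rw [not_le] at hlt
      nlinarith [mul_pos (sub_pos.2 hlt) (sub_pos.2 (hlt.trans hbc))]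
    have hmc : m ≤ c := by
      by_contra hlt
      rw [not_le] at hlt
      nlinarith [mul_pos (sub_pos.2 (hbc.trans hlt)) (sub_pos.2 hlt)]
    have hl0 : 0 ≤ (b + c - m) / (4 * b * c) := le_trans (by positivity) h
    have hl1 : (b + c - m) / (4 * b * c) ≤ 1 / (4 * b) := by
      rw [div_le_div_iff₀ (by positivity) (by positivity)]
      nlinarith
    calc ((b + c - m) / (4 * b * c)) ^ 2 ≤ (1 / (4 * b)) ^ 2 := pow_le_pow_left₀ hl0 hl1 2
      _ = 1 / (16 * b ^ 2) := by field_simp; ring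
      _ ≤ 1 / (16 * a * (2 * m - a)) := one_div_le_one_div_of_le h16 (by nlinarith)

/-- **`L(b)` DIES on the chord**: for `0 < b < c` the law anchored at the left end of the chord fails at the
midpoint `m = (b+c)/2` (`E` is affine and non-constant on `[b,c]`; AM–GM gap `((b+c)/(8bc))² − 1/(16bc) =
(b−c)²/(64b²c²) > 0`). -/
theorem bent_not_law {b c : ℝ} (hb : 0 < b) (hbc : b < c) :
    ¬ ∀ m : ℝ, b < m → (max (1 / (4 * m)) ((b + c - m) / (4 * b * c))) ^ 2 ≤
      max (1 / (4 * b)) ((b + c - b) / (4 * b * c)) *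
        max (1 / (4 * (2 * m - b))) ((b + c - (2 * m - b)) / (4 * b * c)) := by
  intro h
  have hc : 0 < c := by linarith
  have key := h ((b + c) / 2) (by linarith)
  rw [show 2 * ((b + c) / 2) - b = c by ring, bent_at_left hb hc, bent_at_right hb hc] at key
  have hl : (b + c) / (8 * b * c) ≤
      max (1 / (4 * ((b + c) / 2))) ((b + c - (b + c) / 2) / (4 * b * c)) := by
    have e : (b + c - (b + c) / 2) / (4 * b * c) = (b + c) / (8 * b * c) := by
      field_simp
      ring
    rw [← e]
    exact le_max_right _ _
  have hsq : ((b + c) / (8 * b * c)) ^ 2 ≤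
      (max (1 / (4 * ((b + c) / 2))) ((b + c - (b + c) / 2) / (4 * b * c))) ^ 2 :=
    pow_le_pow_left₀ (by positivity) hl 2
  have hgap : 1 / (4 * b) * (1 / (4 * c)) < ((b + c) / (8 * b * c)) ^ 2 := by
    rw [div_pow, show 1 / (4 * b) * (1 / (4 * c)) = 1 / (16 * b * c) by field_simp; ring,
      div_lt_div_iff₀ (by positivity) (by positivity)]
    nlinarith [mul_pos (mul_pos hb hc) (pow_pos (sub_pos.2 hbc) 2)]
  linarith

/-- **Beyond the chord every anchored law holds again** (`a ≥ c`: all three points are harmonic). -/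
theorem bent_law_tail {a b c : ℝ} (hb : 0 < b) (hbc : b < c) (hca : c ≤ a) {m : ℝ} (hm : a < m) :
    (max (1 / (4 * m)) ((b + c - m) / (4 * b * c))) ^ 2 ≤
      max (1 / (4 * a)) ((b + c - a) / (4 * b * c)) *
        max (1 / (4 * (2 * m - a))) ((b + c - (2 * m - a)) / (4 * b * c)) := by
  rw [bent_of_ge hb hbc.le hca, bent_of_ge hb hbc.le (by linarith : c ≤ m),
    bent_of_ge hb hbc.le (by linarith : c ≤ 2 * m - a)]
  have ha : 0 < a := by linarith
  have hm0 : 0 < m := by linarith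
  have h2ma : 0 < 2 * m - a := by linarith
  have h16 : 0 < 16 * a * (2 * m - a) := by positivity
  rw [show (1 / (4 * m)) ^ 2 = 1 / (16 * m ^ 2) by field_simp; ring,
    show 1 / (4 * a) * (1 / (4 * (2 * m - a))) = 1 / (16 * a * (2 * m - a)) by field_simp; ring]
  exact one_div_le_one_div_of_le h16 (by nlinarith [sq_nonneg (m - a)])

/-! ## §2 The two lawful worlds -/

/-- **The secant-bent harmonic world** (the negative answer to N17 / U12).  For all far anchors `1 ≤ a < b`
there is a 3D-LAWFUL functional `W` (symmetric, positively homogeneous, subadditive, monotone in the middle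
argument, sandwiched between `max(x+z, x+y, y+z)` and `x+y+z`) with far pencil
`W(1,x,1) = x + 1 + max(1/(4x), (b+c−x)/(4bc))`, `c = (a²+b²)/(2a)`, such that: `W(1,1,1) = 9/4`; no length
`x ≥ 1` is saturated; **`L_W(a)` holds and `L_W(b)` FAILS**; and `L_W(a')` holds for every `a' ≥ (a²+b²)/(2a)`.
So the upward law `L(a) ⟹ L(b)` is not a consequence of the shape laws, for ANY pair of far anchors. -/
theorem bentWorld {a b : ℝ} (ha : 1 ≤ a) (hab : a < b) :
    ∃ W : ℝ → ℝ → ℝ → ℝ,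
      ((∀ x y z : ℝ, W x y z = W y x z ∧ W x y z = W x z y) ∧
        (∀ ν : ℝ, 0 < ν → ∀ x y z : ℝ, 0 < x → 0 < y → 0 < z →
          W (ν * x) (ν * y) (ν * z) = ν * W x y z) ∧
        (∀ x y z x' y' z' : ℝ, 0 < x → 0 < y → 0 < z → 0 < x' → 0 < y' → 0 < z' →
          W (x + x') (y + y') (z + z') ≤ W x y z + W x' y' z') ∧
        (∀ x y y' z : ℝ, 0 < x → 0 < y → y ≤ y' → 0 < z → W x y z ≤ W x y' z) ∧
        (∀ x y z : ℝ, 0 < x → 0 < y → 0 < z →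
          max (x + z) (max (x + y) (y + z)) ≤ W x y z ∧ W x y z ≤ x + y + z)) ∧
      (∀ x : ℝ, 1 ≤ x → W 1 x 1 = x + 1 +
        max (1 / (4 * x)) ((b + (a ^ 2 + b ^ 2) / (2 * a) - x) / (4 * b * ((a ^ 2 + b ^ 2) / (2 * a))))) ∧
      W 1 1 1 = 9 / 4 ∧
      (∀ x : ℝ, 1 ≤ x → x + 1 < W 1 x 1) ∧
      (∀ m : ℝ, a < m →
        (W 1 m 1 - (m + 1)) ^ 2 ≤ (W 1 a 1 - (a + 1)) * (W 1 (2 * m - a) 1 - (2 * m - a + 1))) ∧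
      (¬ ∀ m : ℝ, b < m →
        (W 1 m 1 - (m + 1)) ^ 2 ≤ (W 1 b 1 - (b + 1)) * (W 1 (2 * m - b) 1 - (2 * m - b + 1))) ∧
      (∀ a' : ℝ, (a ^ 2 + b ^ 2) / (2 * a) ≤ a' → ∀ m : ℝ, a' < m →
        (W 1 m 1 - (m + 1)) ^ 2 ≤ (W 1 a' 1 - (a' + 1)) * (W 1 (2 * m - a') 1 - (2 * m - a' + 1))) := by
  have ha0 : 0 < a := by linarith
  have hb0 : 0 < b := by linarith
  obtain ⟨c, hc_def⟩ : ∃ c : ℝ, c = (a ^ 2 + b ^ 2) / (2 * a) := ⟨_, rfl⟩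
  have h2ca : 2 * c * a = a ^ 2 + b ^ 2 := by
    rw [hc_def]
    field_simp
  have hbc : b < c := by nlinarith [pow_pos (sub_pos.2 hab) 2]
  have hkey : a * (2 * c - a) ≤ b ^ 2 := by nlinarith
  have hc0 : 0 < c := by linarith
  have hb1 : 1 ≤ b := by linarith
  have hc1 : 1 ≤ c := by linarith
  obtain ⟨W, hsym, hhom, hsub, hmono, hsand, hfar, hone⟩ :=
    farTail_realisable (e := fun x : ℝ => max (1 / (4 * x)) ((b + c - x) / (4 * b * c)))
      (bent_convexOn hb0 hc0) (bent_antitoneOn hb0 hc0) (fun x hx => (bent_pos (by linarith)).le)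
      (bent_cube hb1 hc1)
  have hfar' : ∀ x : ℝ, 1 ≤ x → W 1 x 1 = x + 1 + max (1 / (4 * x)) ((b + c - x) / (4 * b * c)) :=
    fun x hx => by rw [hfar x hx]
  have hexc : ∀ x : ℝ, 1 ≤ x → W 1 x 1 - (x + 1) = max (1 / (4 * x)) ((b + c - x) / (4 * b * c)) :=
    fun x hx => by rw [hfar' x hx]; ring
  refine ⟨W, ⟨hsym, hhom, hsub, hmono, hsand⟩, ?_, ?_, ?_, ?_, ?_, ?_⟩
  · intro x hx
    rw [← hc_def]
    exact hfar' x hx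
  · rw [hone]
    show 2 + max (1 / (4 * (1 : ℝ))) ((b + c - 1) / (4 * b * c)) = 9 / 4
    rw [bent_at_one hb1 hc1]
    norm_num
  · intro x hx
    rw [hfar' x hx]
    linarith [bent_pos (b := b) (c := c) (by linarith : 0 < x)]
  · intro m hm
    rw [hexc m (by linarith), hexc a ha, hexc (2 * m - a) (by linarith)]
    exact bent_law ha0 hab hbc hkey hm
  · intro h
    apply bent_not_law hb0 hbc
    intro m hm
    have h' := h m hm
    rwa [hexc m (by linarith), hexc b hb1, hexc (2 * m - b) (by linarith)] at h'
  · intro a' ha' m hm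
    rw [← hc_def] at ha'
    have ha'1 : 1 ≤ a' := by linarith
    rw [hexc m (by linarith), hexc a' ha'1, hexc (2 * m - a') (by linarith)]
    exact bent_law_tail hb0 hbc ha' hm

/-- **The kink world at `b`** (the world of `FarEdgeDescentAnchorLaw.anchoredLaw_insufficient_of_one_lt`, truth set
computed).  For every `b > 1` a 3D-lawful `W` with far excess `(b − x)₊/(b+2)`: the special-leaf shape holds (at
`⌈b⌉`), **`L_W(a')` holds for every `a' ≥ b` and fails for every `1 ≤ a' < b`** — on the far anchors the truth
set is exactly the up-set `[b,∞)` — and `W(1,1,1) = 2 + (b−1)/(b+2)`. -/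
theorem kinkWorld {b : ℝ} (hb : 1 < b) :
    ∃ W : ℝ → ℝ → ℝ → ℝ,
      ((∀ x y z : ℝ, W x y z = W y x z ∧ W x y z = W x z y) ∧
        (∀ ν : ℝ, 0 < ν → ∀ x y z : ℝ, 0 < x → 0 < y → 0 < z →
          W (ν * x) (ν * y) (ν * z) = ν * W x y z) ∧
        (∀ x y z x' y' z' : ℝ, 0 < x → 0 < y → 0 < z → 0 < x' → 0 < y' → 0 < z' →
          W (x + x') (y + y') (z + z') ≤ W x y z + W x' y' z') ∧
        (∀ x y y' z : ℝ, 0 < x → 0 < y → y ≤ y' → 0 < z → W x y z ≤ W x y' z) ∧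
        (∀ x y z : ℝ, 0 < x → 0 < y → 0 < z →
          max (x + z) (max (x + y) (y + z)) ≤ W x y z ∧ W x y z ≤ x + y + z)) ∧
      (∃ K : ℕ, 2 ≤ K ∧ W 1 K 1 = K + 1) ∧
      (∀ a' : ℝ, b ≤ a' → ∀ m : ℝ, a' < m →
        (W 1 m 1 - (m + 1)) ^ 2 ≤ (W 1 a' 1 - (a' + 1)) * (W 1 (2 * m - a') 1 - (2 * m - a' + 1))) ∧
      (∀ a' : ℝ, 1 ≤ a' → a' < b → ¬ ∀ m : ℝ, a' < m →
        (W 1 m 1 - (m + 1)) ^ 2 ≤ (W 1 a' 1 - (a' + 1)) * (W 1 (2 * m - a') 1 - (2 * m - a' + 1))) ∧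
      W 1 1 1 = 2 + (b - 1) / (b + 2) := by
  set c : ℝ := (b + 2)⁻¹ with hc_def
  have hc : 0 < c := by rw [hc_def]; positivity
  set g : ℝ → ℝ := fun x => c • max (b - x) 0 with hg_def
  have hg : ∀ x, g x = c * max (b - x) 0 := fun x => by simp [hg_def, smul_eq_mul]
  have hconv : ConvexOn ℝ (Ici 1) g := by
    have h1 : ConvexOn ℝ (Ici (1 : ℝ)) (fun x : ℝ => b - x) :=
      (convexOn_const (𝕜 := ℝ) b (convex_Ici (1 : ℝ))).sub (concaveOn_id (convex_Ici (1 : ℝ)))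
    have h2 : ConvexOn ℝ (Ici (1 : ℝ)) (fun x : ℝ => max (b - x) 0) :=
      h1.sup (convexOn_const (𝕜 := ℝ) (0 : ℝ) (convex_Ici (1 : ℝ)))
    have h3 : ConvexOn ℝ (Ici (1 : ℝ)) (fun x : ℝ => c • max (b - x) 0) := h2.smul hc.le
    rw [hg_def]; exact h3
  have hanti : AntitoneOn g (Ici 1) := by
    intro x _ y _ hxy
    rw [hg, hg]
    exact mul_le_mul_of_nonneg_left (max_le_max (by linarith) le_rfl) hc.le
  have hnn : ∀ x : ℝ, 1 ≤ x → 0 ≤ g x := fun x _ => by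
    rw [hg]; exact mul_nonneg hc.le (le_max_right _ _)
  have hg1 : g 1 = c * (b - 1) := by rw [hg, max_eq_left (by linarith)]
  have hcube : ∀ x : ℝ, 1 ≤ x → g 1 - g x ≤ (1 - g 1) / 3 * (x - 1) := by
    intro x hx
    have key : (b - 1) - max (b - x) 0 ≤ x - 1 := by
      rcases le_total (b - x) 0 with h | h
      · rw [max_eq_right h]; linarith
      · rw [max_eq_left h]; linarith
    have hc1 : c * (b + 2) = 1 := by rw [hc_def]; exact inv_mul_cancel₀ (by linarith)
    have h3 : (1 - g 1) / 3 = c := by rw [hg1]; linarith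
    rw [h3, hg1, hg]
    nlinarith [mul_le_mul_of_nonneg_left key hc.le]
  obtain ⟨W, hsym, hhom, hsub, hmono, hsand, hfar, hone⟩ := farTail_realisable hconv hanti hnn hcube
  refine ⟨W, ⟨hsym, hhom, hsub, hmono, hsand⟩, ?_, ?_, ?_, ?_⟩
  · refine ⟨⌈b⌉₊, ?_, ?_⟩
    · have h2 : (1 : ℝ) < ⌈b⌉₊ := lt_of_lt_of_le hb (Nat.le_ceil b)
      have h3 : (1 : ℕ) < ⌈b⌉₊ := by exact_mod_cast h2
      omega
    · have hKb : b ≤ (⌈b⌉₊ : ℝ) := Nat.le_ceil b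
      rw [hfar _ (by linarith), hg, max_eq_right (by linarith)]
      ring
  · intro a' hba' m hm
    rw [hfar m (by linarith), hfar a' (by linarith), hfar (2 * m - a') (by linarith), hg m, hg a',
      max_eq_right (by linarith : b - m ≤ 0), max_eq_right (by linarith : b - a' ≤ 0)]
    simp
  · intro a' ha'1 ha'b h
    have key := h ((a' + b) / 2) (by linarith)
    rw [show 2 * ((a' + b) / 2) - a' = b by ring, hfar _ (by linarith), hfar a' ha'1, hfar b hb.le,
      hg ((a' + b) / 2), hg b, max_eq_left (by linarith : (0 : ℝ) ≤ b - (a' + b) / 2),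
      max_eq_right (by linarith : b - b ≤ (0 : ℝ))] at key
    have hpos : 0 < c * (b - (a' + b) / 2) := mul_pos hc (by linarith)
    nlinarith
  · rw [hone, hg1, hc_def, div_eq_inv_mul]

end Summit.MatrixMultiplication.MatrixMultiplication.Theorems.FarEdgeDescentAnchorIndependence

end
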